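import Summits.HodgeConjecture.CorCM.GaloisSkewCountPrime
import Mathlib.Tactic.Linarith
import HarnessLib

/-!
# The REFINED counting condition of the prime-order skew-section theorem: comparison with gen 33's count and exact thresholds
# `|G| ≥ 44` (`p = 2`), `78` (`p = 3`), `150` (`p = 5`), `210` (`p = 7`), `n ≥ 17` (`p = 11, 13`)

COR-CM (cell `pub-hodgecm2`), binder seat b04 (gen 39), count-neutral own lane «Galois-CM-type classification».  KERNEL ONLY, pure
arithmetic (Mathlib only): theorems; no definition, no named fact, no `sorry`.  Companion of `CorCM/GaloisSkewSectionPrimeOrbits`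
(gen 39), whose hypothesis is, with `|G| = 2pn`:

  `(2pn - 1 - m(p-1))·2^(n/2) + m(p-1)·2^((n + (p-1)(n/m))/p) < 2^n`   for every `m ≥ m₀` dividing `n`,

versus gen 33's `2pn·2^(n/2) + m(p-1)·2^((n + n/m)/2) < 2^n` (`CorCM/GaloisSkewCountPrime`).

* `new_le_old` — the refined left-hand side is at most the old one (`(n + (p-1)s)/p ≤ (n + s)/2` for `p ≥ 2`, `s ≤ n`), so every
  threshold lemma of gen 33 transfers (`count'_of_count`, `count'_of_le_two_pow`).
* exact thresholds «for all `m ≥ 2` dividing `n`» by evaluation below gen 33's: **`count'_two`** (`n ≥ 11`, i.e. `|G| ≥ 44`; gen 33: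
  `52`, and `48` only with three conjugates), **`count'_three`** (`n ≥ 13`, `|G| ≥ 78`; gen 33: `84`) and `count'_three_eleven`
  (`|G| = 66`), **`count'_five`** (`n ≥ 15`, `|G| ≥ 150`; gen 33: `170`) and `count'_five_thirteen` (`130`), **`count'_seven`**
  (`n ≥ 15`, `|G| ≥ 210`; gen 33: `238`) and `count'_seven_thirteen` (`182`), `count'_eleven`, `count'_thirteen` (`n ≥ 17`; gen 33: `21`).
  The failures just below are genuine (`p = 5`, `n = 14`, `m = 2`: `18816 > 16384`; `p = 7`, `n = 14`: `26496 > 16384`).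
  KEY CASES: `p = 5, 7` at `n = 16` — the degrees `160 = 32·5` and `224 = 32·7`.

## References

* [Kubota1965] T. Kubota, *On the field extension by complex multiplication*, Trans. AMS 118 (1965), §2 (context only).
-/

namespace Summit.HodgeConjecture.CorCM.GaloisModels.SkewSectionPrime

/-! ## §1 Comparison with the old count -/

/-- `(n + (p-1)s)/p ≤ (n + s)/2` for `p ≥ 2` and `s ≤ n`. [folklore] -/
theorem div_exponent_le (p n s : ℕ) (hp : 2 ≤ p) (hs : s ≤ n) : (n + (p - 1) * s) / p ≤ (n + s) / 2 := by
  obtain ⟨q, rfl⟩ := Nat.exists_eq_add_of_le hp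
  rw [Nat.le_div_iff_mul_le two_pos]
  have h1 : (n + (2 + q - 1) * s) / (2 + q) * 2 ≤ (n + (2 + q - 1) * s) * 2 / (2 + q) := by
    rw [mul_comm, mul_comm (n + (2 + q - 1) * s) 2]; exact Nat.mul_div_le_mul_div_assoc _ _ _
  refine h1.trans ((Nat.div_le_iff_le_mul_add_pred (by omega)).2 ?_)
  have h2 : (2 + q - 1) * s = s + q * s := by rw [show 2 + q - 1 = 1 + q by omega]; ring
  rw [h2]
  nlinarith

/-- **The refined left-hand side is at most gen 33's.** [folklore] -/
theorem new_le_old (p n m : ℕ) (hp : 2 ≤ p) :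
    (2 * p * n - 1 - m * (p - 1)) * 2 ^ (n / 2) + m * (p - 1) * 2 ^ ((n + (p - 1) * (n / m)) / p) ≤
      2 * p * n * 2 ^ (n / 2) + m * (p - 1) * 2 ^ ((n + n / m) / 2) :=
  Nat.add_le_add (Nat.mul_le_mul_right _ (by omega))
    (Nat.mul_le_mul_left _ (Nat.pow_le_pow_right two_pos (div_exponent_le p n (n / m) hp (Nat.div_le_self n m))))

/-- **Gen 33's count implies the refined count** (any lower bound `m₀` on the number of conjugates). [folklore] -/
theorem count'_of_count (p n m₀ : ℕ) (hp : 2 ≤ p)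
    (h : ∀ m, m₀ ≤ m → m ∣ n → 2 * p * n * 2 ^ (n / 2) + m * (p - 1) * 2 ^ ((n + n / m) / 2) < 2 ^ n) :
    ∀ m, m₀ ≤ m → m ∣ n →
      (2 * p * n - 1 - m * (p - 1)) * 2 ^ (n / 2) + m * (p - 1) * 2 ^ ((n + (p - 1) * (n / m)) / p) < 2 ^ n :=
  fun m hm hmn => (new_le_old p n m hp).trans_lt (h m hm hmn)

/-- **The refined count from the clean size condition** `16 ≤ n`, `8p ≤ 2^(n/4)`. [folklore] -/
theorem count'_of_le_two_pow (p n : ℕ) (hp : 2 ≤ p) (hn : 16 ≤ n) (hpa : 8 * p ≤ 2 ^ (n / 4)) :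
    ∀ m, 2 ≤ m → m ∣ n →
      (2 * p * n - 1 - m * (p - 1)) * 2 ^ (n / 2) + m * (p - 1) * 2 ^ ((n + (p - 1) * (n / m)) / p) < 2 ^ n :=
  count'_of_count p n 2 hp (count_of_le_two_pow p n hp hn hpa)

/-! ## §2 Exact thresholds by evaluation -/

/-- **`p = 2`: the refined count from `11 ≤ n`** (`|G| = 4n ≥ 44`; gen 33 needed `52`, or three conjugates at `48`). [folklore] -/
theorem count'_two (n : ℕ) (h11 : 11 ≤ n) :
    ∀ m, 2 ≤ m → m ∣ n →
      (2 * 2 * n - 1 - m * (2 - 1)) * 2 ^ (n / 2) + m * (2 - 1) * 2 ^ ((n + (2 - 1) * (n / m)) / 2) < 2 ^ n := by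
  by_cases h13 : 13 ≤ n
  · exact count'_of_count 2 n 2 le_rfl (count_two n h13)
  intro m hm hmn
  have hmle : m ≤ n := Nat.le_of_dvd (by omega) hmn
  interval_cases n <;> interval_cases m <;> revert hmn <;> decide

/-- **`p = 3`: the refined count from `13 ≤ n`** (`|G| = 6n ≥ 78`; gen 33 needed `84`). [folklore] -/
theorem count'_three (n : ℕ) (h13 : 13 ≤ n) :
    ∀ m, 2 ≤ m → m ∣ n →
      (2 * 3 * n - 1 - m * (3 - 1)) * 2 ^ (n / 2) + m * (3 - 1) * 2 ^ ((n + (3 - 1) * (n / m)) / 3) < 2 ^ n := by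
  by_cases h14 : 14 ≤ n
  · exact count'_of_count 3 n 2 (by norm_num) (count_three_of_fourteen_le n h14)
  intro m hm hmn
  have hmle : m ≤ n := Nat.le_of_dvd (by omega) hmn
  interval_cases n; interval_cases m <;> revert hmn <;> decide

/-- **`p = 3`, `n = 11`** (`|G| = 66`): the refined count holds (the only divisor `m ≥ 2` is `11`). [folklore] -/
theorem count'_three_eleven :
    ∀ m, 2 ≤ m → m ∣ 11 →
      (2 * 3 * 11 - 1 - m * (3 - 1)) * 2 ^ (11 / 2) + m * (3 - 1) * 2 ^ ((11 + (3 - 1) * (11 / m)) / 3) < 2 ^ 11 := by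
  intro m hm hmn
  have hmle : m ≤ 11 := Nat.le_of_dvd (by omega) hmn
  interval_cases m <;> revert hmn <;> decide

/-- **`p = 5`: the refined count from `15 ≤ n`** (`|G| = 10n ≥ 150`; gen 33 needed `170`).  At `n = 16` (`|G| = 160 = 32·5`) the
values are `38656 + 4096 < 65536` (`m = 2`), …. [folklore] -/
theorem count'_five (n : ℕ) (h15 : 15 ≤ n) :
    ∀ m, 2 ≤ m → m ∣ n →
      (2 * 5 * n - 1 - m * (5 - 1)) * 2 ^ (n / 2) + m * (5 - 1) * 2 ^ ((n + (5 - 1) * (n / m)) / 5) < 2 ^ n := by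
  by_cases h17 : 17 ≤ n
  · exact count'_of_count 5 n 2 (by norm_num) (count_five n h17)
  intro m hm hmn
  have hmle : m ≤ n := Nat.le_of_dvd (by omega) hmn
  interval_cases n <;> interval_cases m <;> revert hmn <;> decide

/-- **`p = 5`, `n = 13`** (`|G| = 130`): the refined count holds. [folklore] -/
theorem count'_five_thirteen :
    ∀ m, 2 ≤ m → m ∣ 13 →
      (2 * 5 * 13 - 1 - m * (5 - 1)) * 2 ^ (13 / 2) + m * (5 - 1) * 2 ^ ((13 + (5 - 1) * (13 / m)) / 5) < 2 ^ 13 := by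
  intro m hm hmn
  have hmle : m ≤ 13 := Nat.le_of_dvd (by omega) hmn
  interval_cases m <;> revert hmn <;> decide

/-- **`p = 7`: the refined count from `15 ≤ n`** (`|G| = 14n ≥ 210`; gen 33 needed `238`).  At `n = 16` (`|G| = 224 = 32·7`) the
values are `54016 + 6144 < 65536` (`m = 2`), …. [folklore] -/
theorem count'_seven (n : ℕ) (h15 : 15 ≤ n) :
    ∀ m, 2 ≤ m → m ∣ n →
      (2 * 7 * n - 1 - m * (7 - 1)) * 2 ^ (n / 2) + m * (7 - 1) * 2 ^ ((n + (7 - 1) * (n / m)) / 7) < 2 ^ n := by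
  by_cases h17 : 17 ≤ n
  · exact count'_of_count 7 n 2 (by norm_num) (count_seven n h17)
  intro m hm hmn
  have hmle : m ≤ n := Nat.le_of_dvd (by omega) hmn
  interval_cases n <;> interval_cases m <;> revert hmn <;> decide

/-- **`p = 7`, `n = 13`** (`|G| = 182`): the refined count holds. [folklore] -/
theorem count'_seven_thirteen :
    ∀ m, 2 ≤ m → m ∣ 13 →
      (2 * 7 * 13 - 1 - m * (7 - 1)) * 2 ^ (13 / 2) + m * (7 - 1) * 2 ^ ((13 + (7 - 1) * (13 / m)) / 7) < 2 ^ 13 := by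
  intro m hm hmn
  have hmle : m ≤ 13 := Nat.le_of_dvd (by omega) hmn
  interval_cases m <;> revert hmn <;> decide

/-- **`p = 11`: the refined count from `17 ≤ n`** (gen 33's exact threshold was `21`, its clean lemma `28`). [folklore] -/
theorem count'_eleven (n : ℕ) (h17 : 17 ≤ n) :
    ∀ m, 2 ≤ m → m ∣ n →
      (2 * 11 * n - 1 - m * (11 - 1)) * 2 ^ (n / 2) + m * (11 - 1) * 2 ^ ((n + (11 - 1) * (n / m)) / 11) < 2 ^ n := by
  by_cases h28 : 28 ≤ n
  · exact count'_of_le_two_pow 11 n (by norm_num) (by omega) (by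
      calc (8 * 11 : ℕ) ≤ 2 ^ 7 := by norm_num
        _ ≤ 2 ^ (n / 4) := Nat.pow_le_pow_right two_pos (by omega))
  intro m hm hmn
  have hmle : m ≤ n := Nat.le_of_dvd (by omega) hmn
  interval_cases n <;> interval_cases m <;> revert hmn <;> decide

/-- **`p = 13`: the refined count from `17 ≤ n`** (gen 33's exact threshold was `21`, its clean lemma `28`). [folklore] -/
theorem count'_thirteen (n : ℕ) (h17 : 17 ≤ n) :
    ∀ m, 2 ≤ m → m ∣ n →
      (2 * 13 * n - 1 - m * (13 - 1)) * 2 ^ (n / 2) + m * (13 - 1) * 2 ^ ((n + (13 - 1) * (n / m)) / 13) < 2 ^ n := by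
  by_cases h28 : 28 ≤ n
  · exact count'_of_le_two_pow 13 n (by norm_num) (by omega) (by
      calc (8 * 13 : ℕ) ≤ 2 ^ 7 := by norm_num
        _ ≤ 2 ^ (n / 4) := Nat.pow_le_pow_right two_pos (by omega))
  intro m hm hmn
  have hmle : m ≤ n := Nat.le_of_dvd (by omega) hmn
  interval_cases n <;> interval_cases m <;> revert hmn <;> decide

end Summit.HodgeConjecture.CorCM.GaloisModels.SkewSectionPrime
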